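import Literature.RingTheory.CentralSimple.AlbertTypesNumberField
import Literature.NumberTheory.ComplexMultiplication.CMAlgebraProduct
import Literature.NumberTheory.ComplexMultiplication.CMTypeTraceModuleUnique
import Literature.RepresentationTheory.FiniteMonoids.InverseMonoidAlgebrasProofs
import HarnessLib

/-!
# Positive involutions and CM-algebras; the complex conjugation `ι_E` of a CM-algebra
# (Milne, *Complex Multiplication*, Ch. I §1: "CM-algebras" p. 11, "Positive involutions and CM-algebras" pp. 19–21)

Topic `Literature/NumberTheory/ComplexMultiplication` (lane `lit-hodgefound`, Layer A3, row A3.1.4⁺: the printed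
EQUIVALENT descriptions of a CM-algebra — «a finite product of CM-fields», the tree's
`GaoUllmo2025.IsCMAlgebra E` — by its complex conjugation `ι_E` and by positive involutions).  One definition
with body (`IsCMAlgebra.conj` = `ι_E`), everything else proved; no named fact.

Source READ: J. S. Milne, *Complex Multiplication* (course notes, v0.10, 2020), open text
`paper:url-8ccc30e4daab` (jmilne.org `CM.pdf`; chunk `p00NN` = PDF page NN), verbatim:

* [p0011 L6–L10] «A CM-algebra is a finite product of CM-fields. Equivalently, it is a finite product of number
  fields admitting an automorphism `ι_E` that is nontrivial on each factor and such that `ι ∘ ρ = ρ ∘ ι_E` for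
  all homomorphisms `ρ : E → ℂ`. The fixed algebra of `ι_E` is a product of the largest totally real subfields of
  the factors. Sometimes we call `ι_E` complex conjugation and write `ā` for `ι_E a`.»
* [p0019 L34–L39, p0020 L2] «An involution of `B` is a `k`-linear map `b ↦ b' : B → B` such that `(ab)' = b'a'`
  and `(b')' = b` … An involution `'` on a finite-dimensional `ℚ`-algebra `B` is said to be positive if
  `Tr_{B/ℚ}(b'b) > 0` (13) for every nonzero `b ∈ B`.»
* [p0020 L7–L14] «PROPOSITION 1.36 Every finite-dimensional `ℚ`-algebra admitting a positive involution is
  semisimple. PROOF. Let `B` admit a positive involution `'`, and let `𝔞` be a nilpotent two-sided ideal in `B`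
  … `b = a'a ∈ 𝔞` and is nonzero because `Tr_{B/ℚ}(b) > 0`. As `b = b'`, `Tr_{B/ℚ}(b²) > 0` and so `b² ≠ 0`;
  similarly … `b⁴ ≠ 0`, etc., contradicting the nilpotence of `𝔞`.»
* [p0020 L41–L44] «EXAMPLE 1.38 (a) For a totally real number field `F`, the identity involution is positive.
  (b) For a CM-field `E`, the involution `ι_E` is positive.  PROPOSITION 1.39 Every finite-dimensional
  commutative `ℚ`-algebra with positive involution is a product of pairs as in (1.38).» — proof p0020 L45 –
  p0021 L9: «The involution `'` permutes the set of simple two-sided ideals in `B`, from which it follows easily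
  that `B` decomposes (as a `ℚ`-algebra with involution) into a product each of whose factors is either (a) a
  simple algebra with an involution or (b) the product of two simple algebras interchanged by `'` … Case (b) is
  excluded [footnote 11: for if `B = B₁ × B₂`, then `(a,0)(a,0)' = (a,0)(0,a') = 0`] … we need consider only
  the case that `B` is a field … If they are `(ℝ, id)`, `B` is totally real and `' = id`; if they are `(ℂ, ι)`,
  `B` is a CM-field and `' = ι`.»
* [p0021 L10–L11] «COROLLARY 1.40 The CM-algebras are exactly the finite-dimensional commutative `ℚ`-algebras
  admitting a (unique) positive involution that acts nontrivially on each factor.»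

CARRIERS (all pre-existing): «positive involution» = the tree's `IsPositiveAntiInvolution D ι`
(`RingTheory/CentralSimple/AlbertTypes.lean`: `(xy)' = y'x'`, `x'' = x`, `0 < Tr_{D/ℚ}(x'x)` for `x ≠ 0` with
`Tr_{D/ℚ} = leftMulTrace ℚ D`, which for commutative `D` is `Algebra.trace ℚ D`, `leftMulTrace_eq_algebraTrace`);
«CM-algebra» = `GaoUllmo2025.IsCMAlgebra E` (`∃ Kᵢ CM fields, E ≃ₐ[ℚ] ∏ Kᵢ`); complex conjugation of a CM field =
Mathlib's `NumberField.IsCMField.complexConj`.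

## What is proved (§-numbers of this file)

* §2 **PROP. 1.36** `IsPositiveAntiInvolution.isSemisimpleRing` (any finite-dimensional `ℚ`-algebra; the printed
  nilpotent-ideal argument is the tree's `InverseMonoidAlgebra.isSemisimpleRing_of_star_mul_self`, imported), and
  for commutative `B`: `IsPositiveAntiInvolution.isReduced`.
* §3 Commutative bookkeeping: `'` is an algebra automorphism (`IsAntiInvolution.toAlgEquiv`); **`'` fixes every
  idempotent** (`apply_idempotent` — «case (b) is excluded»); `exists_ringEquiv_pi_numberField` (a reduced
  finite-dimensional commutative `ℚ`-algebra is `≅ ∏ B/𝔪`, a product of number fields — Mathlib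
  `IsArtinianRing.equivPi`); DIAGONALISATION along any `e : B ≃ₐ[ℚ] ∏ᵢ Kᵢ`: the factor involutions
  `ρᵢ = factorHom` with `e(x')ᵢ = ρᵢ(e(x)ᵢ)` (`apply_eq_factorHom`), `Tr_{∏Kᵢ/ℚ} = Σᵢ Tr_{Kᵢ/ℚ}`
  (`algebraTrace_pi`),
  positivity of each `ρᵢ` (`trace_mul_factorHom_pos`), and per factor — by Shimura §5.1 Lemma 2, the tree's
  `NumberFields/PositiveInvolution(CM).lean` — `Kᵢ` totally real with `ρᵢ = id` or CM with `ρᵢ = ι_{Kᵢ}`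
  (`isTotallyReal_or_isCMField_factor`, `factorHom_eq_id_iff`, `factorHom_eq_complexConj`).
* §4 **PROP. 1.39** `IsPositiveAntiInvolution.exists_algEquiv_pi_numberField`: `(B, ') ≅ ∏ᵢ (Kᵢ, ρᵢ)` with every
  `(Kᵢ, ρᵢ)` a pair «as in (1.38)», `(F, id)` with `F` totally real or `(E, ι_E)` with `E` CM.  (Example 1.38
  itself is the tree's `isPositiveAntiInvolution_id` / `isPositiveAntiInvolution_conj`, `AlbertTypes.lean`; the
  ONE-FACTOR case — a positive anti-involution of a number field `K` is `(K, id)` of type I or `(K, conj)` of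
  type IV, and is unique — is the tree's `IsPositiveAntiInvolution.isAlbertTypeI_or_isAlbertTypeIV` /
  `IsPositiveAntiInvolution.unique`, `AlbertTypesNumberField.lean`, whose `IsAntiInvolution.map_one` is reused.)
* §1 (placed after §4 in the file) **`ι_E`**: `IsCMAlgebra.existsUnique_conj` (∃! automorphism `c` with
  `ρ (c a) = conj (ρ a)` for all `ρ : E → ℂ`), DEF `IsCMAlgebra.conj` (= `ι_E`), `emb_conj`, uniqueness
  `eq_conj_of_forall_emb`, `conj_conj`, junction `conjEmb_eq_comp_conj` (the tree's `φ̄` is `φ ∘ ι_E`),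
  `algEquiv_conj_apply` (`ι_E` is coordinatewise `ι_{Kᵢ}` along ANY `E ≅ ∏ Kᵢ`), the fixed algebra
  (`conj_eq_self_iff`, `conj_eq_self_iff_forall_mem_maximalRealSubfield` — «the product of the largest totally
  real subfields of the factors»), «nontrivial on each factor» (`exists_conj_mul_ne`), `conj_field_eq_complexConj`,
  `conj_prod_apply`.
* §5 **COR. 1.40**: `IsCMAlgebra.isPositiveAntiInvolution_conj` («⟹» / Example 1.38 (b) for CM-algebras),
  `isCMAlgebra_of_isPositiveAntiInvolution` («⟸»), **`isCMAlgebra_iff_exists_isPositiveAntiInvolution`** (the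
  corollary as an `↔`), `IsCMAlgebra.eq_conj_of_isPositiveAntiInvolution` («(unique)» in the sharper form: every
  positive involution of a CM-algebra is `ι_E`), `IsCMAlgebra.existsUnique_isPositiveAntiInvolution` (the printed
  uniqueness clause).  «Acts nontrivially on each factor» is rendered on idempotents: for every idempotent `f ≠ 0`
  the involution is not the identity on `fE`; since a positive involution fixes every idempotent
  (`apply_idempotent`) and `fE = ∏_{i ∈ S} Kᵢ`, this is exactly non-triviality on each simple factor `Kᵢ`.
* §6 Validation: `ι_E` of `ℚ(i) × ℚ(i)` is `(z, w) ↦ (z̄, w̄)` and is its ONLY positive involution;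
  `ℚ × ℚ(i)` (a 1.39 pair with a totally real factor) is not a CM-algebra.

Deviations from print: (i) the decomposition into simple factors is taken for the REDUCED commutative `B`
(Prop. 1.36) through `IsArtinianRing.equivPi` rather than by permuting simple two-sided ideals; (ii) «case (b) is
excluded» is proved in the form «a positive involution fixes every idempotent» (same one-line computation as
footnote 11); (iii) the field case is Shimura's §5.1 Lemma 2 as already vendored in the tree (weak approximation)
instead of Milne's passage to `B ⊗_ℚ ℝ`.  NOT here: Prop. 1.37 (positive-definite forms on `B`-modules), the
sentence «an involution on `B` is positive iff its linear extension to `B ⊗_ℚ ℝ` is positive» (p. 20 L5–L6),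
§1 «Classification of the primitive CM-pairs» (1.29–1.35).

## References

* [MilneCM2006] J. S. Milne, *Complex Multiplication* (course notes; v0.00 2006, v0.10 July 14 2020),
  Ch. I §1: "CM-algebras" p. 11; "Positive involutions and CM-algebras" pp. 19–21, Prop. 1.36, Example 1.38,
  Prop. 1.39, Cor. 1.40.
* [Shimura1998] G. Shimura, *Abelian Varieties with Complex Multiplication and Modular Functions* (1998), §5.1
  Lemma 2 (the field case, vendored in `NumberFields/PositiveInvolution.lean`, `PositiveInvolutionCM.lean`).
* [GaoUllmo2025] Z. Gao, E. Ullmo, §2.1 (the definition `IsCMAlgebra`, `Emb`, `conjEmb` used here).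
-/

noncomputable section

open Module
open scoped ComplexConjugate

namespace Literature.NumberTheory.ComplexMultiplication

open Literature.RingTheory.CentralSimple (IsAntiInvolution IsPositiveAntiInvolution)
open Literature.NumberTheory.Automorphic (leftMulTrace leftMulTrace_apply)
open Literature.AlgebraicGeometry.GaoUllmo2025
open NumberField

universe u v w

/-! ## §2 Proposition 1.36: an algebra with a positive involution is semisimple -/

section Semisimple

variable {D : Type u} [Ring D] [Algebra ℚ D] {ι : D →ₗ[ℚ] D}

/-- `(bⁿ)' = (b')ⁿ` for an anti-involution (the powers of one element commute; used for the self-adjoint `b`,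
`b²`, `b⁴`, … of the proof of Prop. 1.36). [cite: MilneCM2006, Ch. I §1 Prop. 1.36 (proof, p. 20)] -/
theorem _root_.Literature.RingTheory.CentralSimple.IsAntiInvolution.map_pow (h : IsAntiInvolution D ι)
    (b : D) (n : ℕ) : ι (b ^ n) = ι b ^ n := by
  induction n with
  | zero => rw [pow_zero, pow_zero, h.map_one]
  | succ n ih => rw [pow_succ, h.map_mul, ih, ← pow_succ']

/-- For a POSITIVE involution `Tr_{D/ℚ}(a'a) > 0` for `a ≠ 0`; in particular `a'a = 0 ⟹ a = 0` (the step
«`b = a'a ≠ 0` because `Tr_{B/ℚ}(b) > 0`» of the proof of Prop. 1.36). [cite: MilneCM2006, Ch. I §1 Prop. 1.36 (proof)] -/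
theorem _root_.Literature.RingTheory.CentralSimple.IsPositiveAntiInvolution.eq_zero_of_apply_mul_self
    (h : IsPositiveAntiInvolution D ι) {a : D} (ha : ι a * a = 0) : a = 0 := by
  by_contra h0
  have := h.trace_pos a h0
  rw [ha, map_zero] at this
  exact lt_irrefl _ this

variable [Module.Finite ℚ D]

/-- **Milne CM, Ch. I Proposition 1.36**: «Every finite-dimensional `ℚ`-algebra admitting a positive involution
is semisimple.»  Printed proof: for a nilpotent two-sided ideal `𝔞` and `0 ≠ a ∈ 𝔞`, `b = a'a ∈ 𝔞` is non-zero
(`Tr(a'a) > 0`) and self-adjoint, so `Tr(b²) > 0`, `b² ≠ 0`, `b⁴ ≠ 0`, …, contradicting the nilpotence of `𝔞`;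
this nilpotent-ideal argument is the tree's `InverseMonoidAlgebra.isSemisimpleRing_of_star_mul_self` (an artinian
ring with a product-reversing involution `⋆` such that `a⋆a = 0 ⟹ a = 0` is semisimple, via the nilpotent
Jacobson radical), fed with `a'a = 0 ⟹ Tr(a'a) = 0 ⟹ a = 0`. [cite: MilneCM2006, Ch. I §1 Prop. 1.36 (p. 20)] -/
theorem _root_.Literature.RingTheory.CentralSimple.IsPositiveAntiInvolution.isSemisimpleRing
    (h : IsPositiveAntiInvolution D ι) : IsSemisimpleRing D := by
  haveI : IsArtinianRing D := IsArtinianRing.of_finite ℚ D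
  exact Literature.RepresentationTheory.FiniteMonoids.InverseMonoidAlgebra.isSemisimpleRing_of_star_mul_self
    ι h.map_mul h.apply_apply fun a ha ↦ h.eq_zero_of_apply_mul_self ha

end Semisimple

/-! ## §3 Positive involutions of COMMUTATIVE algebras: reducedness, idempotents, diagonalisation -/

section Comm

variable {B : Type u} [CommRing B] [Algebra ℚ B] {ι : B →ₗ[ℚ] B}

/-- For commutative `B` the tree's left-multiplication trace `leftMulTrace ℚ B` (the `Tr_{B/ℚ}` of (13) and of
`IsPositiveAntiInvolution`) is Mathlib's `Algebra.trace ℚ B` (definitionally).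
[cite: MilneCM2006, Ch. I §1 (13) (p. 19–20)] -/
theorem leftMulTrace_eq_algebraTrace (x : B) : leftMulTrace ℚ B x = Algebra.trace ℚ B x := rfl

/-- On a commutative algebra an anti-involution is an (involutive) algebra AUTOMORPHISM `x ↦ x'`.
[cite: MilneCM2006, Ch. I §1 (involutions of a commutative `B`, p. 19–21)] -/
def _root_.Literature.RingTheory.CentralSimple.IsAntiInvolution.toAlgEquiv (h : IsAntiInvolution B ι) :
    B ≃ₐ[ℚ] B :=
  AlgEquiv.ofAlgHom
    (AlgHom.ofLinearMap ι h.map_one fun x y ↦ by rw [h.map_mul, mul_comm])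
    (AlgHom.ofLinearMap ι h.map_one fun x y ↦ by rw [h.map_mul, mul_comm])
    (AlgHom.ext fun x ↦ h.apply_apply x) (AlgHom.ext fun x ↦ h.apply_apply x)

/-- `IsAntiInvolution.toAlgEquiv` is `x ↦ x'`. [cite: MilneCM2006, Ch. I §1 (involutions, p. 19)] -/
@[simp]
theorem _root_.Literature.RingTheory.CentralSimple.IsAntiInvolution.toAlgEquiv_apply (h : IsAntiInvolution B ι)
    (x : B) : h.toAlgEquiv x = ι x := rfl

/-- A self-adjoint nilpotent element of a commutative algebra with POSITIVE involution vanishes: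
`b' = b`, `b^{2^{k+1}} = (b^{2^k})' b^{2^k} = 0 ⟹ b^{2^k} = 0`, descending from `b^{2^N} = 0`.
[cite: MilneCM2006, Ch. I §1 Prop. 1.36 (proof)] -/
theorem _root_.Literature.RingTheory.CentralSimple.IsPositiveAntiInvolution.eq_zero_of_isNilpotent_of_apply_eq
    (h : IsPositiveAntiInvolution B ι) {b : B} (hb : ι b = b) (hn : IsNilpotent b) : b = 0 := by
  obtain ⟨N, hN⟩ := hn
  have h2N : b ^ 2 ^ N = 0 := by
    obtain ⟨m, hm⟩ := Nat.exists_eq_add_of_le (Nat.lt_two_pow_self (n := N)).le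
    rw [hm, pow_add, hN, zero_mul]
  have key : ∀ k : ℕ, b ^ 2 ^ k = 0 → k = 0 ∨ b ^ 2 ^ (k - 1) = 0 := by
    intro k hk
    rcases k with _ | k
    · exact Or.inl rfl
    · refine Or.inr ?_
      rw [Nat.add_sub_cancel]
      apply h.eq_zero_of_apply_mul_self
      rw [h.map_pow, hb, ← pow_add, ← two_mul, ← pow_succ']
      exact hk
  -- descend from `N` to `0`
  have desc : ∀ k : ℕ, b ^ 2 ^ k = 0 → b = 0 := by
    intro k
    induction k with
    | zero => intro hk; simpa using hk
    | succ k ih =>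
      intro hk
      rcases key (k + 1) hk with h0 | h0
      · exact absurd h0 (Nat.succ_ne_zero k)
      · rw [Nat.add_sub_cancel] at h0
        exact ih h0
  exact desc N h2N

/-- **Prop. 1.36, commutative case: a commutative finite-dimensional `ℚ`-algebra with a positive involution is
REDUCED** (semisimple commutative = reduced): if `x` is nilpotent then so is the self-adjoint `b = x'x`, hence
`b = 0` and `x = 0`. [cite: MilneCM2006, Ch. I §1 Prop. 1.36 (p. 20)] -/
theorem _root_.Literature.RingTheory.CentralSimple.IsPositiveAntiInvolution.isReduced
    (h : IsPositiveAntiInvolution B ι) : IsReduced B := by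
  refine ⟨fun x hx ↦ ?_⟩
  apply h.eq_zero_of_apply_mul_self
  refine h.eq_zero_of_isNilpotent_of_apply_eq ?_ (Commute.isNilpotent_mul_left (Commute.all (ι x) x) hx)
  rw [h.map_mul, h.apply_apply]

/-- **A positive involution of a commutative algebra fixes every idempotent** («case (b) [the product of two
simple algebras interchanged by `'`] is excluded», footnote 11: «for if `B = B₁ × B₂`, then
`(a,0)(a,0)' = (a,0)(0,a') = 0`»).  With `f = e'`: `(e(1-f))'·e(1-f) = (1-e)f·e(1-f) = 0`, so `e(1-f) = 0` by
positivity, and symmetrically `f(1-e) = 0`; hence `e = ef = f`. [cite: MilneCM2006, Ch. I §1 Prop. 1.39 (proof, p. 20–21, footnote 11)] -/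
theorem _root_.Literature.RingTheory.CentralSimple.IsPositiveAntiInvolution.apply_idempotent
    (h : IsPositiveAntiInvolution B ι) {e : B} (he : IsIdempotentElem e) : ι e = e := by
  set f := ι e with hf
  have hfe : ι f = e := by rw [hf, h.apply_apply]
  have h1 : ι (1 : B) = 1 := h.map_one
  have hee : e * e = e := he
  have hff : f * f = f := by rw [hf, ← h.map_mul, hee]
  -- `e (1 - f) = 0`
  have hA : e * (1 - f) = 0 := by
    apply h.eq_zero_of_apply_mul_self
    have : ι (e * (1 - f)) = (1 - e) * f := by
      rw [h.map_mul, map_sub, h1, hfe, mul_comm]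
    rw [this, show (1 - e) * f * (e * (1 - f)) = (e - e * e) * (f - f * f) by ring, hee, hff, sub_self,
      zero_mul]
  -- `f (1 - e) = 0`
  have hB : f * (1 - e) = 0 := by
    apply h.eq_zero_of_apply_mul_self
    have : ι (f * (1 - e)) = (1 - f) * e := by
      rw [h.map_mul, map_sub, h1, hfe]
    rw [this, show (1 - f) * e * (f * (1 - e)) = (e - e * e) * (f - f * f) by ring, hee, hff, sub_self,
      zero_mul]
  have hA' : e * f = e := by
    have := sub_eq_zero.1 (by rwa [mul_sub, mul_one] at hA)
    exact this.symm
  have hB' : f * e = f := by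
    have := sub_eq_zero.1 (by rwa [mul_sub, mul_one] at hB)
    exact this.symm
  rw [← hB', mul_comm, hA']

end Comm

/-! ## §3b A reduced finite-dimensional commutative `ℚ`-algebra is a product of number fields; diagonalisation -/

section Decomp

/-- Any ring isomorphism between `ℚ`-algebras is a `ℚ`-algebra isomorphism (a `ℚ`-algebra structure is unique,
Mathlib `RingHom.map_rat_algebraMap`). [folklore] -/
def algEquivOfRingEquiv {A C : Type*} [Semiring A] [Semiring C] [Algebra ℚ A] [Algebra ℚ C] (f : A ≃+* C) :
    A ≃ₐ[ℚ] C :=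
  AlgEquiv.ofRingEquiv (f := f) fun r ↦ RingHom.map_rat_algebraMap (f : A →+* C) r

/-- `algEquivOfRingEquiv f` is `f`. [folklore] -/
@[simp]
private theorem algEquivOfRingEquiv_apply {A C : Type*} [Semiring A] [Semiring C] [Algebra ℚ A] [Algebra ℚ C]
    (f : A ≃+* C) (x : A) : algEquivOfRingEquiv f x = f x := rfl

/-- **A reduced finite-dimensional commutative `ℚ`-algebra is a finite product of number fields** (the first
sentence of the proof of Prop. 1.39: «`B` decomposes … into a product each of whose factors is … simple», a
commutative simple finite-dimensional `ℚ`-algebra being a number field): `B ≅ ∏_𝔪 B/𝔪` over the finitely many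
maximal ideals (Mathlib `IsArtinianRing.equivPi`).  Stated with a RING isomorphism so that no choice of
`ℚ`-algebra structure on the factors enters; `algEquivOfRingEquiv` upgrades it.
[cite: MilneCM2006, Ch. I §1 Prop. 1.39 (proof, p. 20–21)] -/
theorem exists_ringEquiv_pi_numberField (B : Type u) [CommRing B] [Algebra ℚ B] [Module.Finite ℚ B]
    [IsReduced B] :
    ∃ (n : Type u) (_ : Fintype n) (K : n → Type u) (_ : ∀ i, Field (K i)) (_ : ∀ i, NumberField (K i)),
      Nonempty (B ≃+* ((i : n) → K i)) := by
  haveI : IsArtinianRing B := IsArtinianRing.of_finite ℚ B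
  haveI : Fintype (MaximalSpectrum B) := Fintype.ofFinite _
  have hNF : ∀ I : MaximalSpectrum B, @NumberField (B ⧸ I.asIdeal) (Ideal.Quotient.field I.asIdeal) := by
    intro I
    have hfin : Module.Finite ℚ (B ⧸ I.asIdeal) :=
      Module.Finite.of_surjective (Ideal.Quotient.mkₐ ℚ I.asIdeal).toLinearMap
        (Ideal.Quotient.mkₐ_surjective ℚ I.asIdeal)
    have hcz : CharZero (B ⧸ I.asIdeal) :=
      charZero_of_injective_algebraMap (algebraMap ℚ (B ⧸ I.asIdeal)).injective
    exact @NumberField.mk (B ⧸ I.asIdeal) (Ideal.Quotient.field I.asIdeal) hcz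
      (by convert hfin; exact Subsingleton.elim _ _)
  exact ⟨MaximalSpectrum B, inferInstance, fun I ↦ B ⧸ I.asIdeal, fun I ↦ Ideal.Quotient.field I.asIdeal, hNF,
    ⟨(IsArtinianRing.equivPi B).toRingEquiv⟩⟩

variable {n : Type v} [DecidableEq n] {K : n → Type w} [∀ i, Field (K i)]

/-- `y · 1ᵢ = (0, …, yᵢ, …, 0)` in a product of rings. [folklore] -/
private theorem mul_single_one (y : (i : n) → K i) (i : n) : y * Pi.single i 1 = Pi.single i (y i) := by
  ext j
  rcases eq_or_ne j i with rfl | hj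
  · simp
  · simp [Pi.single_eq_of_ne hj]

variable [∀ i, NumberField (K i)]

variable {B : Type u} [CommRing B] [Algebra ℚ B] {ι : B →ₗ[ℚ] B}
variable (h : IsPositiveAntiInvolution B ι) (e : B ≃ₐ[ℚ] ((i : n) → K i))

/-- The standard idempotents `e⁻¹(1ᵢ)` of `B ≅ ∏ᵢ Kᵢ`. [folklore] -/
private theorem isIdempotentElem_symm_single_one (i : n) : IsIdempotentElem (e.symm (Pi.single i (1 : K i))) := by
  change e.symm _ * e.symm _ = e.symm _
  rw [← map_mul, ← Pi.single_mul, mul_one]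

include h

/-- A positive involution fixes the standard idempotents of any decomposition `B ≅ ∏ᵢ Kᵢ` (it fixes every
idempotent, `apply_idempotent`): the involution «preserves each factor». [cite: MilneCM2006, Ch. I §1 Prop. 1.39 (proof)] -/
theorem _root_.Literature.RingTheory.CentralSimple.IsPositiveAntiInvolution.apply_symm_single_one
    (i : n) : ι (e.symm (Pi.single i 1)) = e.symm (Pi.single i 1) :=
  h.apply_idempotent (isIdempotentElem_symm_single_one e i)

/-- **Diagonalisation, the factor involutions.** For a positive involution `ι` of the commutative `B` and a
decomposition `e : B ≅ ∏ᵢ Kᵢ` into fields, the involution induced on the factor `Kᵢ`: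
`ρᵢ(y) = e(ι(e⁻¹(0,…,y,…,0)))ᵢ`, a ring endomorphism of `Kᵢ` (this is `'` restricted to the factor `Kᵢ`, which
it preserves). [cite: MilneCM2006, Ch. I §1 Prop. 1.39 (proof, p. 20–21)] -/
def _root_.Literature.RingTheory.CentralSimple.IsPositiveAntiInvolution.factorHom (i : n) : K i →+* K i where
  toFun y := e (ι (e.symm (Pi.single i y))) i
  map_one' := by
    change e (ι (e.symm (Pi.single i 1))) i = 1
    rw [h.apply_symm_single_one e i, e.apply_symm_apply, Pi.single_eq_same]
  map_mul' y z := by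
    change e (ι (e.symm (Pi.single i (y * z)))) i =
      e (ι (e.symm (Pi.single i y))) i * e (ι (e.symm (Pi.single i z))) i
    rw [Pi.single_mul, map_mul, h.map_mul, mul_comm, map_mul, Pi.mul_apply]
  map_zero' := by
    change e (ι (e.symm (Pi.single i 0))) i = 0
    rw [Pi.single_zero, map_zero, map_zero, map_zero, Pi.zero_apply]
  map_add' y z := by
    change e (ι (e.symm (Pi.single i (y + z)))) i =
      e (ι (e.symm (Pi.single i y))) i + e (ι (e.symm (Pi.single i z))) i
    rw [Pi.single_add, map_add, map_add, map_add, Pi.add_apply]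

/-- `ρᵢ(y) = e(ι(e⁻¹(0,…,y,…,0)))ᵢ` (definitional). [cite: MilneCM2006, Ch. I §1 Prop. 1.39 (proof)] -/
theorem _root_.Literature.RingTheory.CentralSimple.IsPositiveAntiInvolution.factorHom_apply
    (i : n) (y : K i) : h.factorHom e i y = e (ι (e.symm (Pi.single i y))) i := rfl

/-- **Diagonalisation**: along any decomposition `B ≅ ∏ᵢ Kᵢ` into fields a positive involution acts
coordinatewise, `e(ι x)ᵢ = ρᵢ(e(x)ᵢ)` — «`B` decomposes (as a `ℚ`-algebra with involution) into a product»,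
case (b) being excluded. [cite: MilneCM2006, Ch. I §1 Prop. 1.39 (proof, p. 20–21)] -/
theorem _root_.Literature.RingTheory.CentralSimple.IsPositiveAntiInvolution.apply_eq_factorHom
    (x : B) (i : n) : e (ι x) i = h.factorHom e i (e x i) := by
  have hx : e.symm (Pi.single i (e x i)) = x * e.symm (Pi.single i 1) := by
    apply e.injective
    rw [map_mul, e.apply_symm_apply, e.apply_symm_apply, mul_single_one]
  rw [h.factorHom_apply, hx, h.map_mul, h.apply_symm_single_one e, map_mul, e.apply_symm_apply, Pi.mul_apply,
    Pi.single_eq_same, one_mul]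

/-- `e(ι(e⁻¹(0,…,y,…,0))) = (0,…,ρᵢ(y),…,0)`. [cite: MilneCM2006, Ch. I §1 Prop. 1.39 (proof)] -/
theorem _root_.Literature.RingTheory.CentralSimple.IsPositiveAntiInvolution.apply_symm_single (i : n) (y : K i) :
    e (ι (e.symm (Pi.single i y))) = Pi.single i (h.factorHom e i y) := by
  ext j
  rw [h.apply_eq_factorHom e, e.apply_symm_apply]
  rcases eq_or_ne j i with rfl | hj
  · rw [Pi.single_eq_same, Pi.single_eq_same]
  · rw [Pi.single_eq_of_ne hj, Pi.single_eq_of_ne hj, map_zero]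

/-- Each factor involution is an involution: `ρᵢ(ρᵢ(y)) = y`. [cite: MilneCM2006, Ch. I §1 Prop. 1.39 (proof)] -/
theorem _root_.Literature.RingTheory.CentralSimple.IsPositiveAntiInvolution.factorHom_factorHom
    (i : n) (y : K i) : h.factorHom e i (h.factorHom e i y) = y := by
  rw [h.factorHom_apply, ← h.apply_symm_single e i y, e.symm_apply_apply, h.apply_apply, e.apply_symm_apply,
    Pi.single_eq_same]

/-- Fixed points along the decomposition: `x' = x` iff `ρᵢ(e(x)ᵢ) = e(x)ᵢ` for all `i` (the totally real
coordinates are unconstrained, the CM coordinates must lie in `Kᵢ⁺`).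
[cite: MilneCM2006, Ch. I §1 (CM-algebras, p. 11) and Prop. 1.39] -/
theorem _root_.Literature.RingTheory.CentralSimple.IsPositiveAntiInvolution.apply_eq_self_iff
    (x : B) : ι x = x ↔ ∀ i, h.factorHom e i (e x i) = e x i := by
  rw [← e.injective.eq_iff, funext_iff]
  simp_rw [h.apply_eq_factorHom e]

variable [Fintype n]

omit [DecidableEq n] h in
/-- `Tr_{∏Kᵢ/ℚ}(y) = Σᵢ Tr_{Kᵢ/ℚ}(yᵢ)`: multiplication by `y` is block-diagonal in the basis `⊔ᵢ (basis of Kᵢ)`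
(the trace form of a product of pairs is the sum of the trace forms of the factors, as used in the proof of
Prop. 1.39 / footnote 11). [cite: MilneCM2006, Ch. I §1 Prop. 1.39 (proof, p. 20–21)] -/
theorem algebraTrace_pi (y : (i : n) → K i) :
    Algebra.trace ℚ ((i : n) → K i) y = ∑ i, Algebra.trace ℚ (K i) (y i) := by
  classical
  let b : ∀ i, Basis (Free.ChooseBasisIndex ℚ (K i)) ℚ (K i) := fun i ↦ Free.chooseBasis ℚ (K i)
  rw [Algebra.trace_apply, LinearMap.trace_eq_matrix_trace ℚ (Pi.basis b)]
  simp only [Matrix.trace, Matrix.diag_apply, LinearMap.toMatrix_apply, Pi.basis_apply, Pi.basis_repr]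
  rw [Fintype.sum_sigma]
  refine Finset.sum_congr rfl fun i _ ↦ ?_
  rw [Algebra.trace_apply, LinearMap.trace_eq_matrix_trace ℚ (b i)]
  simp only [Matrix.trace, Matrix.diag_apply, LinearMap.toMatrix_apply]
  refine Finset.sum_congr rfl fun k _ ↦ ?_
  congr 2
  change (y * Pi.single i (b i k)) i = y i * b i k
  rw [Pi.mul_apply, Pi.single_eq_same]

/-- **Positivity descends to every factor**: `Tr_{Kᵢ/ℚ}(y·ρᵢ(y)) > 0` for `0 ≠ y ∈ Kᵢ` — the trace form of
`x = e⁻¹(0,…,y,…,0)` is `Tr_{B/ℚ}(x'x) = Σⱼ Tr_{Kⱼ/ℚ}((e x' · e x)ⱼ) = Tr_{Kᵢ/ℚ}(ρᵢ(y) y)`.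
[cite: MilneCM2006, Ch. I §1 Prop. 1.39 (proof: `'` is positive on each factor)] -/
theorem _root_.Literature.RingTheory.CentralSimple.IsPositiveAntiInvolution.trace_mul_factorHom_pos
    (i : n) {y : K i} (hy : y ≠ 0) :
    0 < Algebra.trace ℚ (K i) (y * h.factorHom e i y) := by
  set x := e.symm (Pi.single i y) with hx
  have hx0 : x ≠ 0 := by
    intro h0
    apply hy
    have := congrArg (fun z ↦ e z i) h0
    simpa [hx] using this
  have hpos := h.trace_pos x hx0
  have htr : Algebra.trace ℚ B (ι x * x) = Algebra.trace ℚ (K i) (h.factorHom e i y * y) := by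
    rw [← Algebra.trace_eq_of_algEquiv e, map_mul, hx, h.apply_symm_single e i y, e.apply_symm_apply,
      ← Pi.single_mul, algebraTrace_pi, Finset.sum_eq_single i (fun j _ hj ↦ by
        rw [Pi.single_eq_of_ne hj, map_zero]) (fun hi ↦ absurd (Finset.mem_univ i) hi), Pi.single_eq_same]
  rw [leftMulTrace_eq_algebraTrace, htr, mul_comm] at hpos
  exact hpos

/-- `Tr_{Kᵢ/ℚ}(y·ρᵢ(y)) ≥ 0`. [cite: MilneCM2006, Ch. I §1 Prop. 1.39 (proof)] -/
theorem _root_.Literature.RingTheory.CentralSimple.IsPositiveAntiInvolution.trace_mul_factorHom_nonneg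
    (i : n) (y : K i) : 0 ≤ Algebra.trace ℚ (K i) (y * h.factorHom e i y) := by
  by_cases hy : y = 0
  · rw [hy, zero_mul, map_zero]
  · exact (h.trace_mul_factorHom_pos e i hy).le

/-- **Each factor is totally real or CM** (Shimura §5.1 Lemma 2 = the tree's
`isTotallyReal_or_isCMField_of_trace_mul_nonneg`, applied to `(Kᵢ, ρᵢ)`): «the only possibilities for the
factors are `(ℝ, id)` or `(ℂ, ι)` … If they are `(ℝ, id)`, `B` is totally real …; if they are `(ℂ, ι)`, `B` is a
CM-field». [cite: MilneCM2006, Ch. I §1 Prop. 1.39 (proof, p. 21)] -/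
theorem _root_.Literature.RingTheory.CentralSimple.IsPositiveAntiInvolution.isTotallyReal_or_isCMField_factor
    (e : B ≃ₐ[ℚ] ((i : n) → K i)) (i : n) : IsTotallyReal (K i) ∨ IsCMField (K i) :=
  NumberFields.isTotallyReal_or_isCMField_of_trace_mul_nonneg _ (h.trace_mul_factorHom_nonneg e i)

/-- `ρᵢ = id` exactly when the factor `Kᵢ` is totally real («If they are `(ℝ, id)`, `B` is totally real and
`' = id`»). [cite: MilneCM2006, Ch. I §1 Prop. 1.39 (proof, p. 21)] -/
theorem _root_.Literature.RingTheory.CentralSimple.IsPositiveAntiInvolution.factorHom_eq_id_iff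
    (i : n) : h.factorHom e i = RingHom.id (K i) ↔ IsTotallyReal (K i) :=
  NumberFields.eq_id_iff_isTotallyReal_of_trace_mul_nonneg _ (h.trace_mul_factorHom_nonneg e i)

/-- A factor on which `'` is NOT the identity is a CM field («if they are `(ℂ, ι)`, `B` is a CM-field and
`' = ι`»). [cite: MilneCM2006, Ch. I §1 Prop. 1.39 (proof, p. 21)] -/
theorem _root_.Literature.RingTheory.CentralSimple.IsPositiveAntiInvolution.isCMField_of_factorHom_ne_id
    (i : n) (hne : h.factorHom e i ≠ RingHom.id (K i)) : IsCMField (K i) :=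
  NumberFields.isCMField_of_trace_mul_nonneg _ (h.trace_mul_factorHom_nonneg e i) hne

omit [Fintype n] [DecidableEq n] [∀ i, NumberField (K i)] h in
/-- A CM field is not totally real (it is «a totally imaginary quadratic extension of a totally real number
field»). [cite: MilneCM2006, Ch. I §1 Prop. 1.4 (a) (p. 10)] -/
theorem not_isTotallyReal_of_isCMField (L : Type*) [Field L] [NumberField L] [IsCMField L] :
    ¬ IsTotallyReal L := by
  intro hL
  obtain ⟨w⟩ : Nonempty (InfinitePlace L) := inferInstance
  exact (InfinitePlace.not_isReal_iff_isComplex.2 (IsTotallyComplex.isComplex w)) (hL.isReal w)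

/-- On a CM factor `ρᵢ ≠ id`. [cite: MilneCM2006, Ch. I §1 Prop. 1.39 (proof, p. 21)] -/
theorem _root_.Literature.RingTheory.CentralSimple.IsPositiveAntiInvolution.factorHom_ne_id
    (i : n) [IsCMField (K i)] : h.factorHom e i ≠ RingHom.id (K i) := fun hid ↦
  not_isTotallyReal_of_isCMField (K i) ((h.factorHom_eq_id_iff e i).1 hid)

/-- **On a CM factor the involution is complex conjugation**: `ρᵢ = ι_{Kᵢ}` («if they are `(ℂ, ι)`, …
`' = ι`»; the tree's `eq_complexConj_of_trace_mul_nonneg`). [cite: MilneCM2006, Ch. I §1 Prop. 1.39 (proof, p. 21)] -/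
theorem _root_.Literature.RingTheory.CentralSimple.IsPositiveAntiInvolution.factorHom_eq_complexConj
    (i : n) [IsCMField (K i)] (y : K i) :
    h.factorHom e i y = IsCMField.complexConj (K i) y :=
  NumberFields.eq_complexConj_of_trace_mul_nonneg _ (h.trace_mul_factorHom_nonneg e i) (h.factorHom_ne_id e i) y

/-- Coordinate form on a CM factor: `e(ι x)ᵢ = \overline{e(x)ᵢ}`. [cite: MilneCM2006, Ch. I §1 Prop. 1.39] -/
theorem _root_.Literature.RingTheory.CentralSimple.IsPositiveAntiInvolution.apply_eq_complexConj
    (i : n) [IsCMField (K i)] (x : B) :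
    e (ι x) i = IsCMField.complexConj (K i) (e x i) := by
  rw [h.apply_eq_factorHom e, h.factorHom_eq_complexConj e]

/-- Coordinate form on a totally real factor: `e(ι x)ᵢ = e(x)ᵢ`. [cite: MilneCM2006, Ch. I §1 Prop. 1.39] -/
theorem _root_.Literature.RingTheory.CentralSimple.IsPositiveAntiInvolution.apply_eq_self_of_isTotallyReal
    (i : n) [hR : IsTotallyReal (K i)] (x : B) : e (ι x) i = e x i := by
  rw [h.apply_eq_factorHom e, (h.factorHom_eq_id_iff e i).2 hR, RingHom.id_apply]

end Decomp

/-! ## §4 Proposition 1.39: the structure of commutative algebras with positive involution -/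

section Structure

/-- **Milne CM, Ch. I Proposition 1.39**: «Every finite-dimensional commutative `ℚ`-algebra with positive
involution is a product of pairs as in (1.38)», i.e. of pairs `(F, id)` with `F` a totally real number field and
`(E, ι_E)` with `E` a CM field (Example 1.38 (a), (b) = the tree's `isPositiveAntiInvolution_id`,
`isPositiveAntiInvolution_conj`).  Precisely: there are number fields `Kᵢ`, a `ℚ`-algebra isomorphism
`e : B ≅ ∏ᵢ Kᵢ` and ring involutions `ρᵢ` of `Kᵢ` with `e ∘ ' = (∏ᵢ ρᵢ) ∘ e`, and for every `i` either `Kᵢ` is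
totally real and `ρᵢ = id`, or `Kᵢ` is CM and `ρᵢ` is its complex conjugation.  Proof as printed: `B` is
semisimple (1.36), hence `≅ ∏ B/𝔪`; `'` preserves each factor (case (b) excluded) and is positive on it; a number
field with a positive involution is `(F, id)` or `(E, ι_E)` (Shimura §5.1 Lemma 2).
[cite: MilneCM2006, Ch. I §1 Prop. 1.39 (p. 20–21)] -/
theorem _root_.Literature.RingTheory.CentralSimple.IsPositiveAntiInvolution.exists_algEquiv_pi_numberField
    {B : Type u} [CommRing B] [Algebra ℚ B] [Module.Finite ℚ B] {ι : B →ₗ[ℚ] B}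
    (h : IsPositiveAntiInvolution B ι) :
    ∃ (n : Type u) (_ : Fintype n) (K : n → Type u) (_ : ∀ i, Field (K i)) (_ : ∀ i, NumberField (K i))
      (e : B ≃ₐ[ℚ] ((i : n) → K i)) (ρ : ∀ i, K i →+* K i),
      (∀ x i, e (ι x) i = ρ i (e x i)) ∧
        ∀ i, (IsTotallyReal (K i) ∧ ρ i = RingHom.id (K i)) ∨
          (∃ _ : IsCMField (K i), ∀ y, ρ i y = IsCMField.complexConj (K i) y) := by
  classical
  haveI := h.isReduced
  obtain ⟨n, hn, K, hF, hNF, ⟨f⟩⟩ := exists_ringEquiv_pi_numberField B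
  let e : B ≃ₐ[ℚ] ((i : n) → K i) := algEquivOfRingEquiv f
  refine ⟨n, hn, K, hF, hNF, e, fun i ↦ h.factorHom e i, fun x i ↦ h.apply_eq_factorHom e x i, fun i ↦ ?_⟩
  rcases h.isTotallyReal_or_isCMField_factor e i with hR | hC
  · exact Or.inl ⟨hR, (h.factorHom_eq_id_iff e i).2 hR⟩
  · exact Or.inr ⟨hC, fun y ↦ h.factorHom_eq_complexConj e i y⟩

end Structure

/-! ## §1 The complex conjugation `ι_E` of a CM-algebra (p. 11) -/

section CMConj

variable {E : Type} [CommRing E] [Algebra ℚ E]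

/-- **The homomorphisms `E → ℂ` separate the points of a CM-algebra** (each factor `Kᵢ` of `E ≅ ∏ Kᵢ` embeds
in `ℂ`). [cite: MilneCM2006, Ch. I §1 (CM-algebras, p. 11)] -/
theorem _root_.Literature.AlgebraicGeometry.GaoUllmo2025.IsCMAlgebra.eq_of_forall_emb_apply_eq
    (hE : IsCMAlgebra E) {x y : E} (hxy : ∀ φ : Emb E, φ x = φ y) :
    x = y := by
  obtain ⟨n, _, K, _, _, _, ⟨e⟩⟩ := hE
  apply e.injective
  funext i
  obtain ⟨χ⟩ : Nonempty (K i →+* ℂ) := inferInstance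
  have := hxy ((sigmaEmb ⟨i, χ.toRatAlgHom⟩).comp (e : E →ₐ[ℚ] ((i : n) → K i)))
  exact χ.injective (by simpa using this)

/-- The coordinatewise complex conjugation of a product of CM fields, as a `ℚ`-algebra automorphism.
[cite: MilneCM2006, Ch. I §1 (CM-algebras, p. 11)] -/
def piComplexConj {n : Type} (K : n → Type) [∀ i, Field (K i)] [∀ i, NumberField (K i)]
    [∀ i, IsCMField (K i)] : ((i : n) → K i) ≃ₐ[ℚ] ((i : n) → K i) :=
  AlgEquiv.piCongrRight fun i ↦ (IsCMField.complexConj (K i)).restrictScalars ℚ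

/-- `piComplexConj` acts by `ι_{Kᵢ}` on the `i`-th coordinate. [cite: MilneCM2006, Ch. I §1 (CM-algebras, p. 11)] -/
@[simp]
theorem piComplexConj_apply {n : Type} (K : n → Type) [∀ i, Field (K i)] [∀ i, NumberField (K i)]
    [∀ i, IsCMField (K i)] (y : (i : n) → K i) (i : n) :
    piComplexConj K y i = IsCMField.complexConj (K i) (y i) := rfl

/-- Existence of `ι_E`: transport the coordinatewise conjugation of `∏ Kᵢ`; every `φ : E → ℂ` factors through
one `Kᵢ` (`sigmaEmb_surjective`), on which Mathlib's `complexEmbedding_complexConj` gives `φ ∘ ι = conj ∘ φ`.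
[cite: MilneCM2006, Ch. I §1 (CM-algebras, p. 11)] -/
theorem _root_.Literature.AlgebraicGeometry.GaoUllmo2025.IsCMAlgebra.exists_conj (hE : IsCMAlgebra E) :
    ∃ c : E ≃ₐ[ℚ] E, ∀ (φ : Emb E) (x : E), φ (c x) = conj (φ x) := by
  obtain ⟨n, _, K, _, _, hK, ⟨e⟩⟩ := hE
  haveI : ∀ i, IsCMField (K i) := hK
  refine ⟨e.trans ((piComplexConj K).trans e.symm), fun φ x ↦ ?_⟩
  obtain ⟨⟨j, χ⟩, hχ⟩ := sigmaEmb_surjective (φ.comp (e.symm : ((i : n) → K i) →ₐ[ℚ] E))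
  have hφ : ∀ y, φ (e.symm y) = χ (y j) := fun y ↦ by
    simpa using congrArg (fun f : Emb ((i : n) → K i) ↦ f y) hχ.symm
  have hx : φ x = χ (e x j) := by simpa using hφ (e x)
  rw [AlgEquiv.trans_apply, AlgEquiv.trans_apply, hφ, piComplexConj_apply, hx]
  exact IsCMField.complexEmbedding_complexConj (K j) (χ : K j →+* ℂ) (e x j)

/-- **`ι_E` exists and is unique**: a CM-algebra carries exactly one automorphism `ι_E` with `ρ ∘ ι_E = ι ∘ ρ` for
all `ρ : E → ℂ` («admitting an automorphism `ι_E` … such that `ι ∘ ρ = ρ ∘ ι_E` for all homomorphisms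
`ρ : E → ℂ`»; uniqueness because `Hom(E, ℂ)` separates points). [cite: MilneCM2006, Ch. I §1 (CM-algebras, p. 11)] -/
theorem _root_.Literature.AlgebraicGeometry.GaoUllmo2025.IsCMAlgebra.existsUnique_conj (hE : IsCMAlgebra E) :
    ∃! c : E ≃ₐ[ℚ] E, ∀ (φ : Emb E) (x : E), φ (c x) = conj (φ x) := by
  obtain ⟨c, hc⟩ := hE.exists_conj
  exact ⟨c, hc, fun c' hc' ↦ AlgEquiv.ext fun x ↦ hE.eq_of_forall_emb_apply_eq fun φ ↦ by rw [hc, hc']⟩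

/-- **The complex conjugation `ι_E` of a CM-algebra** `E` (Milne: «Sometimes we call `ι_E` complex conjugation
and write `ā` for `ι_E a`»): THE `ℚ`-algebra automorphism of `E` such that `ρ(ι_E a) = \overline{ρ(a)}` for every
homomorphism `ρ : E → ℂ` (`emb_conj`; unique, `eq_conj_of_forall_emb`).  For a CM field it is Mathlib's
`NumberField.IsCMField.complexConj` (`conj_field_eq_complexConj`); along any `E ≅ ∏ Kᵢ` it is coordinatewise
complex conjugation (`algEquiv_conj_apply`). [cite: MilneCM2006, Ch. I §1 (CM-algebras, p. 11)] -/
def _root_.Literature.AlgebraicGeometry.GaoUllmo2025.IsCMAlgebra.conj (hE : IsCMAlgebra E) : E ≃ₐ[ℚ] E :=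
  Classical.choose hE.exists_conj

/-- Defining property of `ι_E`: `ρ(ι_E a) = \overline{ρ(a)}` for all `ρ : E → ℂ` («`ι ∘ ρ = ρ ∘ ι_E`»).
[cite: MilneCM2006, Ch. I §1 (CM-algebras, p. 11)] -/
theorem _root_.Literature.AlgebraicGeometry.GaoUllmo2025.IsCMAlgebra.emb_conj
    (hE : IsCMAlgebra E) (φ : Emb E) (x : E) : φ (hE.conj x) = conj (φ x) :=
  Classical.choose_spec hE.exists_conj φ x

/-- `emb_conj` for ring homomorphisms `E → ℂ`. [cite: MilneCM2006, Ch. I §1 (CM-algebras, p. 11)] -/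
theorem _root_.Literature.AlgebraicGeometry.GaoUllmo2025.IsCMAlgebra.ringHom_conj
    (hE : IsCMAlgebra E) (φ : E →+* ℂ) (x : E) : φ (hE.conj x) = conj (φ x) :=
  hE.emb_conj φ.toRatAlgHom x

/-- **Uniqueness of `ι_E`**: any self-map `c` of `E` with `ρ ∘ c = ι ∘ ρ` for all `ρ : E → ℂ` is `ι_E`.
[cite: MilneCM2006, Ch. I §1 (CM-algebras, p. 11)] -/
theorem _root_.Literature.AlgebraicGeometry.GaoUllmo2025.IsCMAlgebra.eq_conj_of_forall_emb
    (hE : IsCMAlgebra E) {c : E → E}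
    (hc : ∀ (φ : Emb E) (x : E), φ (c x) = conj (φ x)) (x : E) : c x = hE.conj x :=
  hE.eq_of_forall_emb_apply_eq fun φ ↦ by rw [hc, hE.emb_conj]

/-- `ι_E` is an involution. [cite: MilneCM2006, Ch. I §1 (CM-algebras, p. 11)] -/
@[simp]
theorem _root_.Literature.AlgebraicGeometry.GaoUllmo2025.IsCMAlgebra.conj_conj
    (hE : IsCMAlgebra E) (x : E) : hE.conj (hE.conj x) = x :=
  hE.eq_of_forall_emb_apply_eq fun φ ↦ by rw [hE.emb_conj, hE.emb_conj, Complex.conj_conj]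

/-- `ι_E⁻¹ = ι_E`. [cite: MilneCM2006, Ch. I §1 (CM-algebras, p. 11)] -/
theorem _root_.Literature.AlgebraicGeometry.GaoUllmo2025.IsCMAlgebra.conj_symm
    (hE : IsCMAlgebra E) : hE.conj.symm = hE.conj :=
  AlgEquiv.ext fun x ↦ by rw [AlgEquiv.symm_apply_eq, hE.conj_conj]

/-- Junction with the tree's conjugate embedding `φ̄ = ι ∘ φ` (`GaoUllmo2025.conjEmb`): `φ̄ = φ ∘ ι_E`.
[cite: MilneCM2006, Ch. I §1 (CM-algebras and CM-types, p. 11)] -/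
theorem _root_.Literature.AlgebraicGeometry.GaoUllmo2025.IsCMAlgebra.conjEmb_eq_comp_conj
    (hE : IsCMAlgebra E) (φ : Emb E) :
    conjEmb φ = φ.comp (hE.conj : E →ₐ[ℚ] E) :=
  AlgHom.ext fun x ↦ by
    change conj (φ x) = φ (hE.conj x)
    rw [hE.emb_conj]

/-- **`ι_E` is coordinatewise complex conjugation** along ANY isomorphism `e : E ≅ ∏ᵢ Kᵢ` with CM fields `Kᵢ`
(not only the one hidden in `IsCMAlgebra E`). [cite: MilneCM2006, Ch. I §1 (CM-algebras, p. 11)] -/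
theorem _root_.Literature.AlgebraicGeometry.GaoUllmo2025.IsCMAlgebra.algEquiv_conj_apply
    (hE : IsCMAlgebra E) {n : Type} {K : n → Type} [∀ i, Field (K i)]
    [∀ i, NumberField (K i)] [∀ i, IsCMField (K i)] (e : E ≃ₐ[ℚ] ((i : n) → K i)) (x : E) (i : n) :
    e (hE.conj x) i = IsCMField.complexConj (K i) (e x i) := by
  obtain ⟨χ⟩ : Nonempty (K i →+* ℂ) := inferInstance
  apply χ.injective
  have h1 := hE.emb_conj ((sigmaEmb ⟨i, χ.toRatAlgHom⟩).comp (e : E →ₐ[ℚ] ((i : n) → K i))) x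
  simp only [AlgHom.comp_apply, sigmaEmb_apply] at h1
  rw [IsCMField.complexEmbedding_complexConj]
  exact h1

/-- **The fixed algebra of `ι_E`**, intrinsic form: `ι_E x = x` iff `x` is real under every `ρ : E → ℂ`.
[cite: MilneCM2006, Ch. I §1 (CM-algebras, p. 11)] -/
theorem _root_.Literature.AlgebraicGeometry.GaoUllmo2025.IsCMAlgebra.conj_eq_self_iff
    (hE : IsCMAlgebra E) (x : E) : hE.conj x = x ↔ ∀ φ : Emb E, conj (φ x) = φ x := by
  refine ⟨fun hx φ ↦ by rw [← hE.emb_conj, hx], fun hx ↦ hE.eq_of_forall_emb_apply_eq fun φ ↦ ?_⟩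
  rw [hE.emb_conj, hx]

/-- **«The fixed algebra of `ι_E` is a product of the largest totally real subfields of the factors»**: along
`e : E ≅ ∏ᵢ Kᵢ`, `ι_E x = x` iff every coordinate `e(x)ᵢ` lies in the maximal real subfield `Kᵢ⁺`.
[cite: MilneCM2006, Ch. I §1 (CM-algebras, p. 11)] -/
theorem _root_.Literature.AlgebraicGeometry.GaoUllmo2025.IsCMAlgebra.conj_eq_self_iff_forall_mem_maximalRealSubfield
    (hE : IsCMAlgebra E) {n : Type} {K : n → Type}
    [∀ i, Field (K i)] [∀ i, NumberField (K i)] [∀ i, IsCMField (K i)] (e : E ≃ₐ[ℚ] ((i : n) → K i))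
    (x : E) :
    hE.conj x = x ↔ ∀ i, e x i ∈ maximalRealSubfield (K i) := by
  rw [← e.injective.eq_iff, funext_iff]
  refine forall_congr' fun i ↦ ?_
  rw [hE.algEquiv_conj_apply e, IsCMField.complexConj_eq_self_iff]

/-- **`ι_E` is «nontrivial on each factor»**: for every non-zero idempotent `f` of `E` (the unit of a product of
some of the factors) `ι_E` is not the identity on `fE`. [cite: MilneCM2006, Ch. I §1 (CM-algebras, p. 11)] -/
theorem _root_.Literature.AlgebraicGeometry.GaoUllmo2025.IsCMAlgebra.exists_conj_mul_ne
    (hE : IsCMAlgebra E) {f : E} (hf : IsIdempotentElem f) (hf0 : f ≠ 0) :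
    ∃ x, hE.conj (f * x) ≠ f * x := by
  classical
  obtain ⟨n, _, K, _, _, hK, ⟨e⟩⟩ := id hE
  haveI : ∀ i, IsCMField (K i) := hK
  obtain ⟨i, hi⟩ : ∃ i, e f i ≠ 0 := by
    by_contra hall
    push Not at hall
    exact hf0 (e.injective (by rw [map_zero]; exact funext hall))
  have hfi : e f i = 1 := by
    have h2 : e f i * e f i = e f i * 1 := by rw [← Pi.mul_apply, ← map_mul, hf.eq, mul_one]
    exact mul_left_cancel₀ hi h2
  obtain ⟨y, hy⟩ : ∃ y : K i, IsCMField.complexConj (K i) y ≠ y := by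
    by_contra hall
    push Not at hall
    exact IsCMField.complexConj_ne_one (K i) (AlgEquiv.ext hall)
  refine ⟨e.symm (Pi.single i y), fun heq ↦ hy ?_⟩
  have key : e (hE.conj (f * e.symm (Pi.single i y))) i = e (f * e.symm (Pi.single i y)) i :=
    congrArg (fun z ↦ e z i) heq
  rwa [hE.algEquiv_conj_apply e, map_mul, e.apply_symm_apply, Pi.mul_apply, hfi, Pi.single_eq_same,
    one_mul] at key

/-- `ι_E ≠ id` on a non-zero CM-algebra. [cite: MilneCM2006, Ch. I §1 (CM-algebras, p. 11)] -/
theorem _root_.Literature.AlgebraicGeometry.GaoUllmo2025.IsCMAlgebra.conj_ne_refl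
    (hE : IsCMAlgebra E) [Nontrivial E] : hE.conj ≠ AlgEquiv.refl := by
  intro h
  obtain ⟨x, hx⟩ := hE.exists_conj_mul_ne IsIdempotentElem.one one_ne_zero
  exact hx (by rw [h, AlgEquiv.coe_refl, id])

/-- For a CM FIELD, `ι_E` is Mathlib's complex conjugation. [cite: MilneCM2006, Ch. I §1 (CM-algebras, p. 11)] -/
theorem conj_field_eq_complexConj (L : Type) [Field L] [NumberField L] [IsCMField L] (x : L) :
    (isCMAlgebra_field L).conj x = IsCMField.complexConj L x := by
  obtain ⟨φ⟩ : Nonempty (L →+* ℂ) := inferInstance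
  apply φ.injective
  rw [(isCMAlgebra_field L).ringHom_conj φ, IsCMField.complexEmbedding_complexConj]

/-- `ι_{E × E'} = ι_E × ι_{E'}`. [cite: MilneCM2006, Ch. I §1 (CM-algebras, p. 11)] -/
theorem conj_prod_apply {E' : Type} [CommRing E'] [Algebra ℚ E'] (hE : IsCMAlgebra E) (hE' : IsCMAlgebra E')
    (z : E × E') : (hE.prod hE').conj z = (hE.conj z.1, hE'.conj z.2) := by
  refine ((hE.prod hE').eq_conj_of_forall_emb (c := fun z : E × E' ↦ (hE.conj z.1, hE'.conj z.2))
    (fun φ w ↦ ?_) z).symm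
  obtain ⟨ψ | ψ', rfl⟩ := sumEmb_surjective φ
  · rw [sumEmb_inl_apply, sumEmb_inl_apply, hE.emb_conj]
  · rw [sumEmb_inr_apply, sumEmb_inr_apply, hE'.emb_conj]

end CMConj

/-! ## §5 Corollary 1.40: CM-algebras and positive involutions -/

section Cor140

variable {E : Type} [CommRing E] [Algebra ℚ E]

/-- **Example 1.38 (b) for CM-ALGEBRAS / Cor. 1.40 «⟹»: `ι_E` is a positive involution of the CM-algebra `E`** —
`Tr_{E/ℚ}(ā a) = Σᵢ Tr_{Kᵢ/ℚ}(āᵢ aᵢ) > 0` for `a ≠ 0` (each term `≥ 0`, the tree's `trace_mul_complexConj_pos`).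
[cite: MilneCM2006, Ch. I §1 Example 1.38 (b), Cor. 1.40 (p. 20–21)] -/
theorem _root_.Literature.AlgebraicGeometry.GaoUllmo2025.IsCMAlgebra.isPositiveAntiInvolution_conj
    (hE : IsCMAlgebra E) :
    IsPositiveAntiInvolution E hE.conj.toLinearMap := by
  classical
  refine ⟨⟨fun x y ↦ ?_, fun x ↦ ?_⟩, fun x hx ↦ ?_⟩
  · change hE.conj (x * y) = hE.conj y * hE.conj x
    rw [map_mul, mul_comm]
  · change hE.conj (hE.conj x) = x
    exact hE.conj_conj x
  · change 0 < leftMulTrace ℚ E (hE.conj x * x)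
    obtain ⟨n, _, K, _, _, hK, ⟨e⟩⟩ := id hE
    haveI : ∀ i, IsCMField (K i) := hK
    rw [leftMulTrace_eq_algebraTrace, ← Algebra.trace_eq_of_algEquiv e, map_mul, algebraTrace_pi]
    obtain ⟨i, hi⟩ : ∃ i, e x i ≠ 0 := by
      by_contra hall
      push Not at hall
      exact hx (e.injective (by rw [map_zero]; exact funext hall))
    have hterm : ∀ j, (e (hE.conj x) * e x) j = e x j * IsCMField.complexConj (K j) (e x j) := fun j ↦ by
      rw [Pi.mul_apply, hE.algEquiv_conj_apply e, mul_comm]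
    refine Finset.sum_pos' (fun j _ ↦ ?_) ⟨i, Finset.mem_univ i, ?_⟩
    · rw [hterm]
      by_cases h0 : e x j = 0
      · rw [h0, zero_mul, map_zero]
      · exact (NumberFields.trace_mul_complexConj_pos h0).le
    · rw [hterm]
      exact NumberFields.trace_mul_complexConj_pos hi

/-- **Cor. 1.40, «(unique)» — sharp form: EVERY positive involution of a CM-algebra is `ι_E`.**  Along
`E ≅ ∏ Kᵢ` a positive involution is `∏ ρᵢ` with `ρᵢ` positive on the CM field `Kᵢ`; `ρᵢ = id` would make `Kᵢ`
totally real, so `ρᵢ = ι_{Kᵢ}` (Shimura §5.1 Lemma 2). [cite: MilneCM2006, Ch. I §1 Cor. 1.40 (p. 21)] -/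
theorem _root_.Literature.AlgebraicGeometry.GaoUllmo2025.IsCMAlgebra.eq_conj_of_isPositiveAntiInvolution
    (hE : IsCMAlgebra E) {ι : E →ₗ[ℚ] E}
    (h : IsPositiveAntiInvolution E ι) (x : E) : ι x = hE.conj x := by
  classical
  obtain ⟨n, _, K, _, _, hK, ⟨e⟩⟩ := id hE
  haveI : ∀ i, IsCMField (K i) := hK
  apply e.injective
  funext i
  rw [h.apply_eq_complexConj e, hE.algEquiv_conj_apply e]

/-- Cor. 1.40 uniqueness as an equality of linear maps. [cite: MilneCM2006, Ch. I §1 Cor. 1.40 (p. 21)] -/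
theorem _root_.Literature.AlgebraicGeometry.GaoUllmo2025.IsCMAlgebra.linearMap_eq_conj_of_isPositiveAntiInvolution
    (hE : IsCMAlgebra E) {ι : E →ₗ[ℚ] E}
    (h : IsPositiveAntiInvolution E ι) : ι = hE.conj.toLinearMap :=
  LinearMap.ext fun x ↦ hE.eq_conj_of_isPositiveAntiInvolution h x

/-- **Cor. 1.40 «⟸»**: a finite-dimensional commutative `ℚ`-algebra with a positive involution `'` acting
non-trivially on each factor is a CM-algebra.  «Acts nontrivially on each factor» is read on idempotents — for
every idempotent `f ≠ 0` the involution is not the identity on `fE` —, which is the printed clause because `'`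
fixes every idempotent (`apply_idempotent`) and so preserves `fE = ∏_{i ∈ S} Kᵢ`.  Proof: by 1.39,
`E ≅ ∏ Kᵢ` with `' = ∏ ρᵢ`; on the factor `Kᵢ` (idempotent `e⁻¹(1ᵢ)`) `ρᵢ ≠ id`, so `Kᵢ` is CM.
[cite: MilneCM2006, Ch. I §1 Cor. 1.40 (p. 21)] -/
theorem isCMAlgebra_of_isPositiveAntiInvolution [Module.Finite ℚ E] {ι : E →ₗ[ℚ] E}
    (h : IsPositiveAntiInvolution E ι)
    (hnt : ∀ f : E, IsIdempotentElem f → f ≠ 0 → ∃ x, ι (f * x) ≠ f * x) :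
    IsCMAlgebra E := by
  classical
  haveI := h.isReduced
  obtain ⟨n, hn, K, hF, hNF, ⟨f⟩⟩ := exists_ringEquiv_pi_numberField E
  let e : E ≃ₐ[ℚ] ((i : n) → K i) := algEquivOfRingEquiv f
  refine ⟨n, hn, K, hF, hNF, fun i ↦ ?_, ⟨e⟩⟩
  refine h.isCMField_of_factorHom_ne_id e i fun hid ↦ ?_
  have hf0 : e.symm (Pi.single i 1) ≠ 0 := by
    intro h0
    have := congrArg (fun z ↦ e z i) h0
    simp at this
  obtain ⟨x, hx⟩ := hnt (e.symm (Pi.single i 1)) (isIdempotentElem_symm_single_one e i) hf0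
  apply hx
  apply e.injective
  funext j
  rw [h.apply_eq_factorHom e, map_mul, e.apply_symm_apply, Pi.mul_apply]
  rcases eq_or_ne j i with rfl | hj
  · rw [hid, RingHom.id_apply]
  · rw [Pi.single_eq_of_ne hj, zero_mul, map_zero]

/-- **Milne CM, Ch. I Corollary 1.40**: «The CM-algebras are exactly the finite-dimensional commutative
`ℚ`-algebras admitting a (unique) positive involution that acts nontrivially on each factor.»
(«⟹»: `ι_E`, positive by `isPositiveAntiInvolution_conj`, nontrivial on each factor by `exists_conj_mul_ne`;
«⟸»: `isCMAlgebra_of_isPositiveAntiInvolution`; «(unique)»: `existsUnique_isPositiveAntiInvolution`.)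
[cite: MilneCM2006, Ch. I §1 Cor. 1.40 (p. 21)] -/
theorem isCMAlgebra_iff_exists_isPositiveAntiInvolution [Module.Finite ℚ E] :
    IsCMAlgebra E ↔ ∃ ι : E →ₗ[ℚ] E, IsPositiveAntiInvolution E ι ∧
      ∀ f : E, IsIdempotentElem f → f ≠ 0 → ∃ x, ι (f * x) ≠ f * x := by
  constructor
  · intro hE
    exact ⟨hE.conj.toLinearMap, hE.isPositiveAntiInvolution_conj, fun _ hf hf0 ↦ hE.exists_conj_mul_ne hf hf0⟩
  · rintro ⟨ι, h, hnt⟩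
    exact isCMAlgebra_of_isPositiveAntiInvolution h hnt

/-- **Cor. 1.40, the uniqueness clause as printed**: a CM-algebra admits a UNIQUE positive involution acting
non-trivially on each factor, namely `ι_E` (indeed a unique positive involution at all,
`eq_conj_of_isPositiveAntiInvolution`). [cite: MilneCM2006, Ch. I §1 Cor. 1.40 (p. 21)] -/
theorem _root_.Literature.AlgebraicGeometry.GaoUllmo2025.IsCMAlgebra.existsUnique_isPositiveAntiInvolution
    (hE : IsCMAlgebra E) :
    ∃! ι : E →ₗ[ℚ] E, IsPositiveAntiInvolution E ι ∧
      ∀ f : E, IsIdempotentElem f → f ≠ 0 → ∃ x, ι (f * x) ≠ f * x :=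
  ⟨hE.conj.toLinearMap, ⟨hE.isPositiveAntiInvolution_conj, fun _ hf hf0 ↦ hE.exists_conj_mul_ne hf hf0⟩,
    fun _ hι ↦ hE.linearMap_eq_conj_of_isPositiveAntiInvolution hι.1⟩

end Cor140

/-! ## §6 Validation -/

section Validation

open CMTypeCount (GaussianField)

/-- `ι_E` of the CM-algebra `ℚ(i) × ℚ(i)` (not a field) is `(z, w) ↦ (z̄, w̄)` (validation of «a finite product
of number fields admitting an automorphism `ι_E` …»). [cite: MilneCM2006, Ch. I §1 (CM-algebras, p. 11)] -/
theorem conj_gaussian_prod (z : GaussianField × GaussianField) :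
    isCMAlgebra_gaussian_prod.conj z =
      (IsCMField.complexConj GaussianField z.1, IsCMField.complexConj GaussianField z.2) := by
  have h := conj_prod_apply (isCMAlgebra_field GaussianField) (isCMAlgebra_field GaussianField) z
  rw [conj_field_eq_complexConj, conj_field_eq_complexConj] at h
  exact h

/-- The only positive involution of `ℚ(i) × ℚ(i)` is `(z, w) ↦ (z̄, w̄)`; in particular the swap-twisted
involutive automorphism `(z, w) ↦ (w̄, z̄)` is NOT positive — «case (b) is excluded».
[cite: MilneCM2006, Ch. I §1 Prop. 1.39 (proof, footnote 11), Cor. 1.40] -/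
theorem eq_of_isPositiveAntiInvolution_gaussian_prod {ι : GaussianField × GaussianField →ₗ[ℚ] _}
    (h : IsPositiveAntiInvolution (GaussianField × GaussianField) ι) (z : GaussianField × GaussianField) :
    ι z = (IsCMField.complexConj GaussianField z.1, IsCMField.complexConj GaussianField z.2) := by
  rw [isCMAlgebra_gaussian_prod.eq_conj_of_isPositiveAntiInvolution h, conj_gaussian_prod]

/-- `ℚ × ℚ(i)` — a Prop. 1.39 pair `(ℚ, id) × (ℚ(i), conj)` with a totally real factor — is NOT a CM-algebra:
a positive involution fixes the idempotent `(1, 0)`, hence acts trivially on the factor `ℚ = (1,0)·(ℚ × ℚ(i))`,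
so `ι_E` could not be «nontrivial on each factor». [cite: MilneCM2006, Ch. I §1 Example 1.38, Prop. 1.39, Cor. 1.40] -/
theorem not_isCMAlgebra_rat_prod_gaussian : ¬ IsCMAlgebra (ℚ × GaussianField) := by
  intro hE
  have hidem : IsIdempotentElem (((1 : ℚ), (0 : GaussianField)) : ℚ × GaussianField) := by
    change ((1 : ℚ), (0 : GaussianField)) * ((1 : ℚ), (0 : GaussianField)) = ((1 : ℚ), (0 : GaussianField))
    ext <;> simp
  obtain ⟨x, hx⟩ := hE.exists_conj_mul_ne hidem (by simp)
  apply hx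
  have h1 : (((1 : ℚ), (0 : GaussianField)) : ℚ × GaussianField) * x =
      algebraMap ℚ (ℚ × GaussianField) x.1 * ((1 : ℚ), (0 : GaussianField)) := by
    ext <;> simp [Algebra.algebraMap_eq_smul_one]
  rw [h1, map_mul, AlgEquiv.commutes]
  congr 1
  exact hE.isPositiveAntiInvolution_conj.apply_idempotent hidem

end Validation

end Literature.NumberTheory.ComplexMultiplication

end
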